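import Summits.CriticalPhenomena.PercolationContinuityZ3.Theorems.PercAnnulusCrossingIICCorollaries
import Summits.CriticalPhenomena.PercolationContinuityZ3.Theorems.PercNearOneGluingNoHeavyRsw3SetToSetHardCrossing
import Summits.CriticalPhenomena.PercolationContinuityZ3.Theorems.PercAnnulusCrossingSetToSetQuasiMult
import Summits.CriticalPhenomena.PercolationContinuityZ3.Theorems.PercAnnulusCrossingTubeRateGeometricRSW
import Summits.CriticalPhenomena.PercolationContinuityZ3.Theorems.PercAnnulusCrossingSetToSetHighDimAspect
import HarnessLib

/-!
# RSW3 lane (lead, gen 13): what the single open LANE-4 input (A2)□ at `p_c(ℤ³)` buys, in one statement — and why it cannot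
# be proved dimension-uniformly

builds on p205010 (kernel theorem, internal audit signed; external expert review pending) — the IIC theorem of p1 gen 3 (V76) in the chain
does not use it; the doubling equivalence V6 and the one-arm lower bounds do (see the cited files).

Cell `prim-rsw3` (LANE 3), lead seat, gen 13.  Support file (`--supports stmt-CriticalPhenomena-4575`); no definitions, no named facts, no
sorries; PURE ASSEMBLY of accepted lane theorems, for planners and LANE 4 (one decl to cite).

* **`setToSetQuasiMult_consequences`** — `Crossing.SetToSetQuasiMult` (Basu–Sapozhnikov's (A2) at `p_c(ℤ³)`, box form; OPEN) implies ALL of: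
  `KestenIICExists` (Kesten's incipient infinite cluster on `ℤ³`; p1 gen 3 / lead gen 4, `kestenIICExists_of_setToSetQuasiMult`, V76),
  `GeometricHardCrossingLowerBound` (the lower half of 3-D RSW with geometric constants; p2 gen 16, V150), `HardCrossingLowerBound k` for every
  `k ≥ 1` and the cube lower bound `CrossingLowerBound cubeShape 0` (ibid.), bounded `n·μ_{p_c}(n)` for the tube correlation length (lead gen 4,
  V74, `geometricHardCrossingLowerBound_iff_rate_bounded`), `OneArmQuasiMult` and `OneArmDoubling` (lead gen 3 / p1 gen 2, V51/V6,
  `oneArmDoubling_of_setToSetQM`).  So the single open input of the printed IIC construction for `ℤ³` dominates the whole (S1-lo) column and the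
  (S2-one-arm) column of the lane's ladder.
* **`setToSetQuasiMult_consequences_highDim_caveat`** — re-export of the unconditional high-dimensional verdict (lead gen 13, V154): there is
  `d₀` such that for every `d ≥ d₀` the `d`-dimensional analogue `∃ ϰ > 0, SetToSetQuasiMultAt d (criticalProbI d) ϰ` is FALSE while one-arm
  doubling HOLDS — any proof of the hypothesis of `setToSetQuasiMult_consequences` must use a feature of `ℤ³` absent above six dimensions.

References: Basu–Sapozhnikov, ECP 22 (2017) no. 26, §1 (A2), Thm. 1.1 [BasuSapozhnikov2017ECP]; Kesten, *Percolation Theory for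
Mathematicians* (1982) §3.3 [Kesten1982]; Borgs–Chayes–Kesten–Spencer 1999 §1 [BorgsChayesKestenSpencer1999].
-/

noncomputable section

namespace Summit.CriticalPhenomena.PercolationContinuityZ3.Theorems.Crossing

open MeasureTheory Filter Topology
open Literature.Probability.Percolation Literature.Probability.LatticeModels
open Summit.CriticalPhenomena.PercolationContinuityZ3.Theorems.Rsw3

/-- **WHAT (A2)□ AT `p_c(ℤ³)` BUYS.**  If `Crossing.SetToSetQuasiMult` holds (Basu–Sapozhnikov's quasi-multiplicativity (A2) at `p_c(ℤ³)`, box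
form — OPEN), then: Kesten's IIC exists on `ℤ³`; the hard-direction crossing probabilities of the tubes `{0..Kn} × {0..n}²` are `≥ c^K` (geometric RSW
lower half), in particular `HardCrossingLowerBound k` for every `k ≥ 1` and the cube is crossed with probability `≥ c`; the tube correlation length
satisfies `n·μ_{p_c}(n) ≤ C`; and the one-arm probabilities are quasi-multiplicative at ratio 4 and doubling (`π(2n) ≥ c·π(n)`).  Pure assembly of
V76 (p1/lead), V150 (p2 gen 16), V74 (lead gen 4), V51/V6 (lead gen 3 / p1 gen 2).
[cite: BasuSapozhnikov2017ECP, §1 assumption (A2) and Thm. 1.1] [cite: Kesten1982, §3.3 Comment (v)] -/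
theorem setToSetQuasiMult_consequences (h : SetToSetQuasiMult) :
    KestenIICExists ∧ GeometricHardCrossingLowerBound ∧ (∀ k : ℕ, 1 ≤ k → HardCrossingLowerBound k) ∧
      CrossingLowerBound cubeShape 0 ∧
      (∃ C : ℝ, ∀ n : ℕ, 1 ≤ n →
        (n : ℝ) * -(subadditive_log_hardCrossing (criticalProbI 3)
          (by rw [coe_criticalProbI]; exact criticalProb_zd_pos 3 (by norm_num)) n).lim ≤ C) ∧
      OneArmQuasiMult ∧ OneArmDoubling := by
  have hp : 0 < ((criticalProbI 3 : unitInterval) : ℝ) := by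
    rw [coe_criticalProbI]; exact criticalProb_zd_pos 3 (by norm_num)
  have hgeo : GeometricHardCrossingLowerBound := geometricHardCrossingLowerBound_of_setToSetQuasiMult h
  obtain ⟨ϰ, hϰ, hA2⟩ := h
  have hqm : OneArmQuasiMult ∧ OneArmDoubling :=
    oneArmDoubling_of_setToSetQM hϰ (fun m hm Z hZ X hX Y hY => by
      have h' := hA2 m hm Z hZ X hX Y hY
      rwa [← mul_assoc] at h')
  exact ⟨kestenIICExists_of_setToSetQuasiMult ⟨ϰ, hϰ, hA2⟩, hgeo,
    fun k hk => hardCrossingLowerBound_of_setToSetQuasiMult ⟨ϰ, hϰ, hA2⟩ hk,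
    crossingLowerBound_cubeShape_of_setToSetQuasiMult ⟨ϰ, hϰ, hA2⟩,
    (geometricHardCrossingLowerBound_iff_rate_bounded hp).1 hgeo, hqm.1, hqm.2⟩

/-- **The caveat, re-exported**: the `d`-dimensional analogue of the hypothesis is FALSE in every sufficiently high dimension (no named fact), while
one-arm doubling holds there — so `SetToSetQuasiMult` admits no dimension-uniform proof, and is strictly stronger than doubling `d`-uniformly
(lead gen 13, `…SetToSetHighDimAspect`). [cite: BasuSapozhnikov2017ECP, §1.2 (third bullet)] [cite: Hara2008, Thm. 1.1] -/
theorem setToSetQuasiMult_consequences_highDim_caveat :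
    ∃ d₀ : ℕ, ∀ d : ℕ, d₀ ≤ d →
      (¬ ∃ ϰ : ℝ, 0 < ϰ ∧ SetToSetQuasiMultAt d (criticalProbI d) ϰ) ∧
        ∃ c : ℝ, 0 < c ∧ OneArmDoublingAt d (criticalProbI d) c := by
  obtain ⟨d₁, h₁⟩ := exists_forall_not_setToSetQuasiMultAt_criticalProbI
  obtain ⟨d₂, h₂⟩ := exists_forall_oneArmDoublingAt_criticalProbI
  refine ⟨max d₁ d₂, fun d hd => ⟨?_, h₂ d ((le_max_right _ _).trans hd)⟩⟩
  rintro ⟨ϰ, hϰ, hA2⟩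
  exact h₁ d ((le_max_left _ _).trans hd) ϰ hϰ hA2

end Summit.CriticalPhenomena.PercolationContinuityZ3.Theorems.Crossing
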